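import Summits.Ventures.PercRepro.C041TriDomContract

/-!
# ROW C-041 — THEOREM (REDUCTION TO SIMPLE CORES): THE OPEN CORE OF CONJECTURE (STOCHASTIC DOMINATION) HAS NO
DOUBLE EDGE
(p6, gen 47; P6-TWOEXIT-LEAN.md §53 ADDENDUM 19)

The inductions of g45 / g46 (`cyc_and_sib_of_noCut`, `cyc_and_sib_of_stockedCore`) run over the statuses of ONE host;
their base case still contains the statuses with DOUBLE edges (contracted pieces), whose double-classes behave like
single vertices without being vertices — a markless lobe on such a class attached by three free edges at three of its
vertices is a cut vertex of the contracted multigraph but no cut vertex of the host.  Here the induction runs over ALL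
hosts on the fixed finite types (`ZoneData V₁ E₁ U₁ U₂` is a variable of the induction), and a double edge
`f = p–q` is CONTRACTED by THEOREM (CONTRACTION OF A DOUBLE EDGE) (`C041TriDomContract`): the status `stAbs st f` of
`contractHost Z₁ p q` has one present edge fewer, and the marks are renamed.  The stock is kept on the HOST-TOUCHED
pairs (`StockedH`: every pair of distinct vertices that are ends of some edge of the host has at least `npres st` absent
edges) — the literal `Stocked` implies it (`stockedH_of_stocked`), every reduction keeps it (`stockedH_stOutS`, …,
`stockedH_stDbl`, mirrors of g46), and so does the contraction (`stockedH_contract`: the renamed vertex `q` is touched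
by no edge of the contracted host).  **THEOREM (REDUCTION TO SIMPLE CORES)** (`cyc_and_sib_of_noDoubleCore`): if
CONJECTURE (STOCHASTIC DOMINATION) and the sibling domination hold, for all marks, on every host-stocked status of
every host WITHOUT A DOUBLE EDGE (`NoDouble`) and without a cut, a two-exit piece, a redundant edge, a parallel pair or
a markless 2-cut far side, they hold on every host-stocked status of every host; for a plain host
(`cycDomination_of_noDoubleCore_host`) through its stocked host.  READING: in the base case the present edges are all
FREE and form a SIMPLE graph (a free loop is redundant, two free edges with the same ends are a parallel pair), every
unmarked vertex has degree `≥ 3`, no vertex and no pair of vertices cuts off a markless part — the open core is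
«simple and 3-connected modulo the marks», with no caveat about contracted classes.
-/

namespace PercRepro

namespace ZoneZ

namespace MultiExit

open ZoneData Finset Classical

variable {V₁ E₁ U₁ U₂ : Type} (Z₁ : ZoneData V₁ E₁ U₁ U₂)

/-! ## The stock on the host-touched pairs -/

/-- A vertex touched by some edge of the host. -/
def HostTouched (u : V₁) : Prop := ∃ e : E₁, Z₁.fst e = u ∨ Z₁.snd e = u

section Stock

variable [Fintype E₁] [DecidableEq E₁]

/-- A status is host-stocked: every pair of distinct host-touched vertices has at least `npres st` absent edges joining
it. -/
def StockedH (st : E₁ → EStat) : Prop :=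
  ∀ u v : V₁, u ≠ v → HostTouched Z₁ u → HostTouched Z₁ v → npres st ≤ stock Z₁ st u v

omit [DecidableEq E₁] in
/-- A stocked status is host-stocked. -/
theorem stockedH_of_stocked {st : E₁ → EStat} (hs : Stocked Z₁ st) : StockedH Z₁ st :=
  fun u v huv _ _ => hs u v huv

omit [DecidableEq E₁] in
/-- A status with fewer present edges and more absent edges stays host-stocked. -/
theorem stockedH_of_le {st st' : E₁ → EStat} (hs : StockedH Z₁ st) (hn : npres st' ≤ npres st)
    (h : ∀ e, st e = EStat.absent → st' e = EStat.absent) : StockedH Z₁ st' :=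
  fun u v huv hu hv => hn.trans ((hs u v huv hu hv).trans (stock_mono Z₁ h u v))

omit [DecidableEq E₁] in
/-- `stOutS` keeps a status host-stocked. -/
theorem stockedH_stOutS {st : E₁ → EStat} (hs : StockedH Z₁ st) (v w : V₁) : StockedH Z₁ (stOutS Z₁ st v w) :=
  stockedH_of_le Z₁ hs (npres_le_of_pres fun _ he => (presE_stOutS Z₁ st v w he).1) (absent_stOutS Z₁ v w)

/-- `stDel` keeps a status host-stocked. -/
theorem stockedH_stDel {st : E₁ → EStat} (hs : StockedH Z₁ st) (f₁ f₂ : E₁) : StockedH Z₁ (stDel st f₁ f₂) :=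
  stockedH_of_le Z₁ hs (npres_le_of_pres fun _ he => (presE_stDel he).1) (absent_stDel f₁ f₂)

/-- `stAbs` keeps a status host-stocked. -/
theorem stockedH_stAbs {st : E₁ → EStat} (hs : StockedH Z₁ st) (f : E₁) : StockedH Z₁ (stAbs st f) :=
  stockedH_of_le Z₁ hs (npres_le_of_pres fun _ he => (presE_stAbs he).1) (absent_stAbs f)

/-- `stCon` keeps a status host-stocked. -/
theorem stockedH_stCon {st : E₁ → EStat} (hs : StockedH Z₁ st) {f : E₁} (hf : st f = EStat.free) :
    StockedH Z₁ (stCon st f) :=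
  stockedH_of_le Z₁ hs (le_of_eq (npres_stCon_eq hf)) (absent_stCon hf)

omit [DecidableEq E₁] in
/-- `stOut2S` keeps a status host-stocked. -/
theorem stockedH_stOut2S {st : E₁ → EStat} (hs : StockedH Z₁ st) (u v w : V₁) :
    StockedH Z₁ (stOut2S Z₁ st u v w) :=
  stockedH_of_le Z₁ hs (npres_le_of_pres fun e he => by
    unfold presE stOut2S at he
    by_cases h : InC2S Z₁ st u v w e
    · rw [if_pos h] at he
      exact absurd rfl he
    · rw [if_neg h] at he
      exact he) (absent_stOut2S Z₁ u v w)

/-- The chord status of a host-stocked status with two present far edges is host-stocked. -/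
theorem stockedH_stChord {st : E₁ → EStat} (hs : StockedH Z₁ st) {u v w : V₁} (c₀ : E₁) (h : TwoFar Z₁ st u v w) :
    StockedH Z₁ (stChord Z₁ st u v w c₀) := by
  intro a b hab ha hb
  have h1 := npres_stChord_lt Z₁ c₀ h
  have h2 := hs a b hab ha hb
  have h3 := stock_mono Z₁ (absent_stOut2S Z₁ (st := st) u v w) a b
  have h4 := stock_update_ge Z₁ (st := stOut2S Z₁ st u v w) c₀ EStat.free a b
  unfold stChord
  unfold stChord at h1
  omega

/-- The double-chord status of a host-stocked status with two present far edges is host-stocked. -/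
theorem stockedH_stDbl {st : E₁ → EStat} (hs : StockedH Z₁ st) {u v w : V₁} (c₀ : E₁) (h : TwoFar Z₁ st u v w) :
    StockedH Z₁ (stDbl Z₁ st u v w c₀) := by
  intro a b hab ha hb
  have h1 := npres_stDbl_lt Z₁ c₀ h
  have h2 := hs a b hab ha hb
  have h3 := stock_mono Z₁ (absent_stOut2S Z₁ (st := st) u v w) a b
  have h4 := stock_update_ge Z₁ (st := stOut2S Z₁ st u v w) c₀ EStat.double a b
  unfold stDbl
  unfold stDbl at h1
  omega

/-! ## A host-stocked status has a chord for every host-touched pair -/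

omit [DecidableEq E₁] in
/-- A host-stocked status with a present edge has an absent edge joining any two distinct host-touched vertices. -/
theorem exists_chord_of_stockedH {st : E₁ → EStat} (hs : StockedH Z₁ st) {u v : V₁} (huv : u ≠ v)
    (hu : HostTouched Z₁ u) (hv : HostTouched Z₁ v) (hn : 0 < npres st) :
    ∃ c₀ : E₁, st c₀ = EStat.absent ∧ Z₁.Joins c₀ u v := by
  have h : 0 < stock Z₁ st u v := lt_of_lt_of_le hn (hs u v huv hu hv)
  unfold stock at h
  obtain ⟨c₀, hc₀⟩ := Finset.card_pos.mp h
  rw [Finset.mem_filter] at hc₀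
  exact ⟨c₀, hc₀.2.1, hc₀.2.2⟩

/-- On a host-stocked status, a markless far side with two present edges on a pair of distinct host-touched vertices
is a 2-cut in the sense of `HasTwoCut` (the chord is in stock): the base case of the reduction has no such far side. -/
theorem hasTwoCut_of_stockedH {st : E₁ → EStat} (hs : StockedH Z₁ st) {a b c u v w : V₁} (hwu : w ≠ u)
    (hwv : w ≠ v) (huv : u ≠ v) (hu : HostTouched Z₁ u) (hv : HostTouched Z₁ v) (ha : a ∉ side2 Z₁ st u v w)
    (hb : b ∉ side2 Z₁ st u v w) (hc : c ∉ side2 Z₁ st u v w) (hfar : TwoFar Z₁ st u v w) :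
    HasTwoCut Z₁ st a b c := by
  obtain ⟨c₀, hc₀, hj⟩ := exists_chord_of_stockedH Z₁ hs huv hu hv (by
    have := npres_stOut2S_add_two_le Z₁ hfar
    omega)
  exact ⟨u, v, w, c₀, hwu, hwv, hc₀, hj, ha, hb, hc, hfar⟩

/-! ## The stock survives the contraction -/

omit [Fintype E₁] [DecidableEq E₁] in
/-- A vertex touched by the contracted host is touched by the host (the image `p` of a `q`-end is an end of `f`). -/
theorem hostTouched_of_contract {p q : V₁} {f : E₁} (hj : Z₁.Joins f p q) {u : V₁}
    (hu : HostTouched (contractHost Z₁ p q) u) : HostTouched Z₁ u := by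
  obtain ⟨e, he⟩ := hu
  have key : ∀ w : V₁, ren p q w = u → (∃ e : E₁, Z₁.fst e = w ∨ Z₁.snd e = w) → HostTouched Z₁ u := by
    intro w hw hw'
    rcases ren_eq_p_or_self p q w with h | h
    · rw [h] at hw
      rw [← hw]
      unfold ZoneData.Joins at hj
      rcases hj with ⟨h1, _⟩ | ⟨_, h2⟩
      · exact ⟨f, Or.inl h1⟩
      · exact ⟨f, Or.inr h2⟩
    · rw [h] at hw
      rw [← hw]
      exact hw'
  rcases he with he | he
  · exact key (Z₁.fst e) he ⟨e, Or.inl rfl⟩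
  · exact key (Z₁.snd e) he ⟨e, Or.inr rfl⟩

omit [Fintype E₁] [DecidableEq E₁] in
/-- A vertex touched by the contracted host is fixed by the renaming. -/
theorem ren_eq_self_of_hostTouched_contract {p q u : V₁} (hu : HostTouched (contractHost Z₁ p q) u) :
    ren p q u = u := by
  by_cases hpq : p = q
  · unfold ren
    split_ifs with h
    · rw [hpq, h]
    · rfl
  · obtain ⟨e, he⟩ := hu
    have huq : u ≠ q := by
      rcases he with he | he
      · rw [← he]
        exact (not_touches_q Z₁ hpq e).1
      · rw [← he]
        exact (not_touches_q Z₁ hpq e).2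
    exact ren_of_ne huq

omit [Fintype E₁] [DecidableEq E₁] in
/-- An absent edge of `Z₁` joining two vertices fixed by the renaming joins them in the contracted host. -/
theorem joins_contract_of_fixed {p q : V₁} {e : E₁} {u v : V₁} (hu : ren p q u = u) (hv : ren p q v = v)
    (h : Z₁.Joins e u v) : (contractHost Z₁ p q).Joins e u v := by
  have := joins_contract_of_joins Z₁ (p := p) (q := q) h
  rw [hu, hv] at this
  exact this

/-- The stock of a pair fixed by the renaming does not drop under the contraction. -/
theorem stock_contract_ge {st : E₁ → EStat} {p q : V₁} {f : E₁} (hf : st f = EStat.double) {u v : V₁}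
    (hu : ren p q u = u) (hv : ren p q v = v) :
    stock Z₁ st u v ≤ stock (contractHost Z₁ p q) (stAbs st f) u v := by
  unfold stock
  apply Finset.card_le_card
  intro e he
  rw [Finset.mem_filter] at he ⊢
  refine ⟨he.1, ?_, joins_contract_of_fixed Z₁ hu hv he.2.2⟩
  have hef : e ≠ f := by
    intro h
    rw [h, hf] at he
    exact absurd he.2.1 (by decide)
  unfold stAbs
  rw [if_neg hef]
  exact he.2.1

/-- The contraction of a double edge keeps a status host-stocked. -/
theorem stockedH_contract {st : E₁ → EStat} (hs : StockedH Z₁ st) {p q : V₁} {f : E₁} (hf : st f = EStat.double)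
    (hj : Z₁.Joins f p q) : StockedH (contractHost Z₁ p q) (stAbs st f) := by
  intro u v huv hu hv
  have h1 := hs u v huv (hostTouched_of_contract Z₁ hj hu) (hostTouched_of_contract Z₁ hj hv)
  have h2 := stock_contract_ge Z₁ hf (ren_eq_self_of_hostTouched_contract Z₁ hu)
    (ren_eq_self_of_hostTouched_contract Z₁ hv)
  have h3 : npres (stAbs st f) < npres st := npres_stAbs_lt (by rw [presE, hf]; decide)
  omega

end Stock

/-! ## THEOREM (REDUCTION TO SIMPLE CORES) -/

/-- A status without double edges. -/
def NoDouble (st : E₁ → EStat) : Prop := ∀ e, st e ≠ EStat.double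

section Induction

variable [Fintype E₁] [DecidableEq E₁]

/-- The induction step at a status with a double edge: contract it. -/
theorem step_of_double (st : E₁ → EStat) (hs : StockedH Z₁ st) (a b c : V₁) {f : E₁} (hf : st f = EStat.double)
    (ih : ∀ (Z' : ZoneData V₁ E₁ U₁ U₂) (st' : E₁ → EStat), StockedH Z' st' → muTE st' < muTE st →
      ∀ a' b' c' : V₁, CycDominationS Z' a' b' c' st' ∧ SibDominationS Z' a' b' c' st') :
    CycDominationS Z₁ a b c st ∧ SibDominationS Z₁ a b c st := by
  have hj : Z₁.Joins f (Z₁.fst f) (Z₁.snd f) := Or.inl ⟨rfl, rfl⟩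
  have hlt : muTE (stAbs st f) < muTE st :=
    μ_lt_of_npres_lt st (npres_stAbs_lt (by rw [presE, hf]; decide))
  have IH := ih (contractHost Z₁ (Z₁.fst f) (Z₁.snd f)) (stAbs st f) (stockedH_contract Z₁ hs hf hj) hlt
    (ren (Z₁.fst f) (Z₁.snd f) a) (ren (Z₁.fst f) (Z₁.snd f) b) (ren (Z₁.fst f) (Z₁.snd f) c)
  exact ⟨cycDominationS_of_contract Z₁ st a b c hf hj IH.1, sibDominationS_of_contract Z₁ st a b c hf hj IH.2⟩

/-- **THEOREM (REDUCTION TO SIMPLE CORES)**: if the conjecture and the sibling domination hold, for all marks, on every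
host-stocked status without a double edge, a cut, a two-exit piece, a redundant edge, a parallel pair or a markless
2-cut far side, of every host on the given types, then they hold on every host-stocked status of every host. -/
theorem cyc_and_sib_of_noDoubleCore
    (hbase : ∀ (Z : ZoneData V₁ E₁ U₁ U₂) (st : E₁ → EStat), StockedH Z st → NoDouble st → ∀ a b c : V₁,
      ¬ HasCut Z st a b c → ¬ HasTwoExit Z st a b c → ¬ HasRedundant Z st → ¬ HasParallel Z st →
      ¬ HasTwoCut Z st a b c → CycDominationS Z a b c st ∧ SibDominationS Z a b c st) :
    ∀ (Z : ZoneData V₁ E₁ U₁ U₂) (st : E₁ → EStat), StockedH Z st → ∀ a b c : V₁,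
      CycDominationS Z a b c st ∧ SibDominationS Z a b c st := by
  suffices h : ∀ n : ℕ, ∀ (Z : ZoneData V₁ E₁ U₁ U₂) (st : E₁ → EStat), muTE st = n → StockedH Z st →
      ∀ a b c : V₁, CycDominationS Z a b c st ∧ SibDominationS Z a b c st from
    fun Z st => h _ Z st rfl
  intro n
  induction n using Nat.strong_induction_on with
  | _ n ih =>
    intro Z st hst hs a b c
    have ih' : ∀ (Z' : ZoneData V₁ E₁ U₁ U₂) (st' : E₁ → EStat), StockedH Z' st' → muTE st' < muTE st →
        ∀ a' b' c' : V₁, CycDominationS Z' a' b' c' st' ∧ SibDominationS Z' a' b' c' st' :=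
      fun Z' st' hs' hlt => ih (muTE st') (hst ▸ hlt) Z' st' rfl hs'
    by_cases hd : ∃ f, st f = EStat.double
    · obtain ⟨f, hf⟩ := hd
      exact step_of_double Z st hs a b c hf ih'
    · have hnd : NoDouble st := fun e he => hd ⟨e, he⟩
      by_cases hcut : HasCut Z st a b c
      · obtain ⟨v, w, hw, ⟨e₀, he₀, hp₀⟩, hcase⟩ := hcut
        have hlt := npres_stOutS_lt Z st v w he₀ hp₀
        have IH := ih' Z (stOutS Z st v w) (stockedH_stOutS Z hs v w) (μ_lt_of_npres_lt st hlt)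
        rcases hcase with ⟨rfl, ha, hb⟩ | ⟨rfl, hb, hc⟩ | ⟨rfl, ha, hc⟩ | ⟨ha, hb, hc⟩
        · exact ⟨cycDominationS_of_cutVertex Z st a b w v hw ha hb (IH a b v).1 (IH a b v).2,
            sibDominationS_of_cutVertex_terminal Z st a b w v hw ha hb (IH a b v).2⟩
        · exact ⟨(cycDominationS_rot Z st w b c).mpr
              (cycDominationS_of_cutVertex Z st b c w v hw hb hc (IH b c v).1 (IH b c v).2),
            sibDominationS_of_cutVertex_markx Z st w b c v hw hb hc (IH v b c).2⟩
        · exact ⟨(cycDominationS_rot Z st a w c).mpr ((cycDominationS_rot Z st w c a).mpr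
              (cycDominationS_of_cutVertex Z st c a w v hw hc ha (IH c a v).1 (IH c a v).2)),
            sibDominationS_of_cutVertex_marky Z st a w c v hw ha hc (IH a v c).2⟩
        · exact ⟨cycDominationS_of_marklessSide Z st v w hw a b c ha hb hc (IH a b c).1,
            sibDominationS_of_marklessSide Z st v w hw a b c ha hb hc (IH a b c).2⟩
      · by_cases h2 : HasTwoExit Z st a b c
        · obtain ⟨K, u, v, f₁, f₂, hT, ha, hb, hc⟩ := h2
          have IH₀ := ih' Z (stDel st f₁ f₂) (stockedH_stDel Z hs f₁ f₂) (μ_stDel_lt Z hT) a b c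
          have IH₁ := ih' Z (stCon st f₁) (stockedH_stCon Z hs hT.hs₁) (μ_stCon_lt hT.hs₁) a b c
          exact ⟨cycDominationS_of_twoExit Z hT a b c ha hb hc IH₀.1 IH₁.1,
            sibDominationS_of_twoExit Z hT a b c ha hb hc IH₀.2 IH₁.2⟩
        · by_cases h3 : HasRedundant Z st
          · obtain ⟨f, p, q, hf, hj, hpq⟩ := h3
            have IH := ih' Z (stAbs st f) (stockedH_stAbs Z hs f) (μ_stAbs_lt hf) a b c
            exact ⟨cycDominationS_of_redundant Z hf hj hpq a b c IH.1,
              sibDominationS_of_redundant Z hf hj hpq a b c IH.2⟩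
          · by_cases h4 : HasParallel Z st
            · obtain ⟨f₁, f₁', p, q, p', q', hP⟩ := h4
              have IH₀ := ih' Z (stAbs (stCon st f₁) f₁') (stockedH_stAbs Z (stockedH_stCon Z hs hP.hs₁) f₁')
                (μ_stAbsCon_lt hP.hne hP.hs₁ hP.hs₁') a b c
              have IH₁ := ih' Z (stAbs st f₁) (stockedH_stAbs Z hs f₁) (μ_stAbs_lt hP.hs₁) a b c
              exact ⟨cycDominationS_of_parallel Z hP a b c IH₀.1 IH₁.1,
                sibDominationS_of_parallel Z hP a b c IH₀.2 IH₁.2⟩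
            · by_cases h5 : HasTwoCut Z st a b c
              · obtain ⟨u, v, w, c₀, hwu, hwv, hc₀, hc, ha, hb, hcm, hfar⟩ := h5
                have IHN := ih' Z (stOut2S Z st u v w) (stockedH_stOut2S Z hs u v w) (muTE_stOut2S_lt Z hfar) a b c
                have IHD := ih' Z (stDbl Z st u v w c₀) (stockedH_stDbl Z hs c₀ hfar) (muTE_stDbl_lt Z c₀ hfar) a b c
                have IHC := ih' Z (stChord Z st u v w c₀) (stockedH_stChord Z hs c₀ hfar) (muTE_stChord_lt Z c₀ hfar)
                  a b c
                exact ⟨cycDominationS_of_twoCut Z hwu hwv hc₀ hc a b c ha hb hcm IHN.1 IHD.1 IHC.1,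
                  sibDominationS_of_twoCut Z hwu hwv hc₀ hc a b c ha hb hcm IHN.2 IHD.2 IHC.2⟩
              · exact hbase Z st hs hnd a b c hcut h2 h3 h4 h5

/-- CONJECTURE (STOCHASTIC DOMINATION) on every host-stocked status of every host, from the simple cores. -/
theorem cycDominationS_of_noDoubleCore
    (hbase : ∀ (Z : ZoneData V₁ E₁ U₁ U₂) (st : E₁ → EStat), StockedH Z st → NoDouble st → ∀ a b c : V₁,
      ¬ HasCut Z st a b c → ¬ HasTwoExit Z st a b c → ¬ HasRedundant Z st → ¬ HasParallel Z st →
      ¬ HasTwoCut Z st a b c → CycDominationS Z a b c st ∧ SibDominationS Z a b c st)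
    (Z : ZoneData V₁ E₁ U₁ U₂) {st : E₁ → EStat} (hs : StockedH Z st) (x y z : V₁) : CycDominationS Z x y z st :=
  (cyc_and_sib_of_noDoubleCore hbase Z st hs x y z).1

end Induction

/-! ## Plain hosts -/

section Host

variable [Fintype E₁] [DecidableEq E₁] [Fintype V₁] [DecidableEq V₁]

/-- **THEOREM (REDUCTION TO SIMPLE CORES, PLAIN HOSTS)**: CONJECTURE (STOCHASTIC DOMINATION) on a finite host follows
from the conjecture and the sibling domination on the host-stocked statuses WITHOUT DOUBLE EDGES of the hosts on the
types of its stocked host that have no cut, no two-exit piece, no redundant edge, no parallel pair and no markless 2-cut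
far side — the simple graphs that are «3-connected modulo the marks». -/
theorem cycDomination_of_noDoubleCore_host
    (hbase : ∀ (Z : ZoneData V₁ (E₁ ⊕ Chords (V₁ := V₁) (E₁ := E₁)) U₁ U₂)
      (st : E₁ ⊕ Chords (V₁ := V₁) (E₁ := E₁) → EStat), StockedH Z st → NoDouble st → ∀ a b c : V₁,
      ¬ HasCut Z st a b c → ¬ HasTwoExit Z st a b c → ¬ HasRedundant Z st → ¬ HasParallel Z st →
      ¬ HasTwoCut Z st a b c → CycDominationS Z a b c st ∧ SibDominationS Z a b c st)
    (x y z : V₁) : CycDomination Z₁ x y z :=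
  cycDominationS_of_lift Z₁ (fun _ => EStat.free) x y z
    (cycDominationS_of_noDoubleCore hbase (stockedHost Z₁) (stockedH_of_stocked _ (stocked_liftSt Z₁ _)) x y z)

end Host

end MultiExit

end ZoneZ

end PercRepro
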